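import Summits.QuantumFields.YangMills.Theorems.EntropyBudgetEquipartitionBudgetRate
import Literature.MathematicalPhysics.QuantumFieldTheory.LatticeGaugeStaticPotentialProofs
import HarnessLib

/-!
# Route `EntropyBudgetEquipartition`, crux `EntropyBudgetTransfer` (stmt-QuantumFields-22401) — helper KT1 per plaquette

HONEST LABEL: a helper toward a RECORD-label rung (R2ξ-G); nothing here bears on the Yang–Mills mass
gap itself.

The sibling file `EntropyBudgetEquipartitionBudgetRate.lean` turns the free-energy RATE (crux
`FreeEnergyRate`) into the budget rate `|β E[s₀] − 3D/2| ≤ C' β^{−κ/2}` for the Wilson SITE energy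
`s₀ = Σ_{i<j} (N − Re tr r(U_{0,ij}))` (six plaquettes). Item 22401 speaks of ONE plaquette
(`plaqCost0 r.ρ 1 2 = fun U => N − plaquetteObs r.ρ 0 1 2 U`). The passage is the hypercubic symmetry
of the torus Wilson state (tree `wilsonExpectation_comp_configPerm`, `plaquetteHolonomy_configPerm`):

* `exists_perm_pair` — a coordinate permutation taking the ordered pair `(i, j)` to `(k, l)`;
* `wilsonExpectation_plaqCost_eq` — the mean cost of the plaquette at the origin is the same in
  every (ordered) plane; `wilsonExpectation_siteEnergy_eq_card_mul` — the mean site energy is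
  `#planes ×` the mean cost of one plaquette (`#planes = 6` in `d = 4`);
* `budgetRate_torus_plane` — `K1 ⇒` for `β ≥ β₁`, eventually in `L`,
  `|β ⟨N − Re tr r(U_{0,ij})⟩_{β,L+1} − D/4| ≤ C' β^{−κ/2}` (`i < j`; the vocabulary of item 22401);
* `budgetRate_limitStates_plane` — the same for every torus-limit state `μ`.

References: R. B. Griffiths, J. Math. Phys. 5 (1964) 1215; S. Friedli, Y. Velenik, *Statistical
Mechanics of Lattice Systems*, CUP 2017, Thm. 3.34; E. Seiler, LNP 159 (1982) §2 (lattice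
symmetries of the Wilson state). [FriedliVelenik2017] [SeilerLNP1982]
-/

noncomputable section

namespace Summit.QuantumFields.YangMills.Theorems.EntropyBudgetEquipartition.BudgetRate

open MeasureTheory Filter Topology
open Literature.MathematicalPhysics.QuantumLattice Literature.MathematicalPhysics.QuantumFieldTheory

/-! ### Plane independence of the mean plaquette cost on the torus -/

/-- For `i ≠ j` and `k ≠ l` there is a permutation of the axes with `π i = k`, `π j = l`. [folklore] -/
theorem exists_perm_pair {d : ℕ} {i j k l : Fin d} (hij : i ≠ j) (hkl : k ≠ l) :
    ∃ π : Equiv.Perm (Fin d), π i = k ∧ π j = l := by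
  set j' := Equiv.swap i k j with hj'
  have hjk : j' ≠ k := by
    intro h
    have h' : Equiv.swap i k j = Equiv.swap i k i := by rw [Equiv.swap_apply_left]; exact h
    exact hij ((Equiv.swap i k).injective h').symm
  refine ⟨Equiv.swap j' l * Equiv.swap i k, ?_, ?_⟩
  · rw [Equiv.Perm.mul_apply, Equiv.swap_apply_left, Equiv.swap_apply_of_ne_of_ne hjk.symm hkl]
  · rw [Equiv.Perm.mul_apply, ← hj', Equiv.swap_apply_left]

variable {d N : ℕ} {G : Type} [Group G] [TopologicalSpace G] [IsTopologicalGroup G] [CompactSpace G]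
  [MeasurableSpace G] [BorelSpace G] (ρ : G →* Matrix (Fin N) (Fin N) ℂ)

omit [IsTopologicalGroup G] [CompactSpace G] [BorelSpace G] in
/-- The permuted origin is the origin. [folklore] -/
theorem sitePerm_zero {M : ℕ} (π : Equiv.Perm (Fin d)) : sitePerm π (0 : Site d M) = 0 := by
  funext q; simp

/-- **The mean cost of the plaquette at the origin is the same in every plane** (invariance of the
torus Wilson state under permutations of the coordinate axes). [cite: SeilerLNP1982, Ch. 2] -/
theorem wilsonExpectation_plaqCost_eq (hρ : Continuous ρ) (β : ℝ) (M : ℕ) [NeZero M]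
    {i j k l : Fin d} (hij : i ≠ j) (hkl : k ≠ l) :
    wilsonExpectation (L := M) ρ β
        (fun U : GaugeConfig d M G => (N : ℝ) - (ρ (plaquetteHolonomy U 0 i j)).trace.re) =
      wilsonExpectation (L := M) ρ β
        (fun U : GaugeConfig d M G => (N : ℝ) - (ρ (plaquetteHolonomy U 0 k l)).trace.re) := by
  obtain ⟨π, hi, hj⟩ := exists_perm_pair hij hkl
  rw [← wilsonExpectation_comp_configPerm (d := d) (L := M) ρ hρ β π
    (fun U : GaugeConfig d M G => (N : ℝ) - (ρ (plaquetteHolonomy U 0 k l)).trace.re)]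
  congr 1
  funext U
  have hk : π.symm k = i := by rw [← hi, Equiv.symm_apply_apply]
  have hl : π.symm l = j := by rw [← hj, Equiv.symm_apply_apply]
  simp only [Function.comp_apply, plaquetteHolonomy_configPerm, sitePerm_zero, hk, hl]

/-- The cost of one plaquette is integrable for the torus Wilson state. [folklore] -/
theorem integrable_plaqCost [SecondCountableTopology G] (hρ : Continuous ρ) (β : ℝ) {M : ℕ}
    [NeZero M] (x : Site d M) (i j : Fin d) :
    Integrable (fun U : GaugeConfig d M G => (N : ℝ) - (ρ (plaquetteHolonomy U x i j)).trace.re)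
      (wilsonMeasure ρ β) := by
  haveI := isProbabilityMeasure_wilsonMeasure (d := d) (L := M) (G := G) ρ hρ β
  obtain ⟨B, hB0, hB⟩ := exists_bound_trace_re_nonneg ρ hρ
  refine Integrable.of_bound ?_ ((N : ℝ) + B) (ae_of_all _ fun U => ?_)
  · exact (measurable_const.sub
      ((continuous_trace_re ρ hρ).measurable.comp (measurable_plaquetteHolonomy x i j)))
      |>.aestronglyMeasurable
  · rw [Real.norm_eq_abs]
    refine (abs_sub _ _).trans ?_
    rw [Nat.abs_cast]
    exact add_le_add le_rfl (hB _)

/-- **The mean site energy is `#planes ×` the mean cost of one plaquette.** [cite: SeilerLNP1982, Ch. 2] -/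
theorem wilsonExpectation_siteEnergy_eq_card_mul [SecondCountableTopology G] (hρ : Continuous ρ)
    (β : ℝ) (M : ℕ) [NeZero M] {k l : Fin d} (hkl : k ≠ l) :
    wilsonExpectation (L := M) ρ β (fun U : GaugeConfig d M G => ∑ i : Fin d, ∑ j : Fin d,
        if i < j then ((N : ℝ) - (ρ (plaquetteHolonomy U 0 i j)).trace.re) else 0) =
      (Fintype.card {q : Fin d × Fin d // q.1 < q.2} : ℝ) *
        wilsonExpectation (L := M) ρ β
          (fun U : GaugeConfig d M G => (N : ℝ) - (ρ (plaquetteHolonomy U 0 k l)).trace.re) := by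
  have hS : (fun U : GaugeConfig d M G => ∑ i : Fin d, ∑ j : Fin d,
      if i < j then ((N : ℝ) - (ρ (plaquetteHolonomy U 0 i j)).trace.re) else 0) =
      fun U => ∑ q : {p : Fin d × Fin d // p.1 < p.2},
        ((N : ℝ) - (ρ (plaquetteHolonomy U 0 q.1.1 q.1.2)).trace.re) := by
    funext U
    exact (EquipartitionPinsProbe.Equipartition.sum_planes
      fun i j => (N : ℝ) - (ρ (plaquetteHolonomy U 0 i j)).trace.re).symm
  rw [hS]
  unfold wilsonExpectation
  rw [integral_finsetSum _ fun q _ => integrable_plaqCost ρ hρ β 0 q.1.1 q.1.2]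
  have hq : ∀ q : {p : Fin d × Fin d // p.1 < p.2},
      ∫ U, ((N : ℝ) - (ρ (plaquetteHolonomy U 0 q.1.1 q.1.2)).trace.re) ∂(wilsonMeasure ρ β) =
        ∫ U, ((N : ℝ) - (ρ (plaquetteHolonomy U 0 k l)).trace.re)
          ∂(wilsonMeasure (d := d) (L := M) ρ β) :=
    fun q => wilsonExpectation_plaqCost_eq ρ hρ β M (ne_of_lt q.2) hkl
  rw [Finset.sum_congr rfl fun q _ => hq q, Finset.sum_const, Finset.card_univ, nsmul_eq_mul]

/-! ### KT1 per plaquette (`d = 4`) -/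

omit [MeasurableSpace G] [BorelSpace G] [TopologicalSpace G] [IsTopologicalGroup G] [CompactSpace G] in
/-- Read on periodic configurations, the cost of the plaquette at the origin of `ℤ^d` is the torus
plaquette cost at the origin. [folklore] -/
theorem toTorusObservable_plaqCost (M : ℕ) (i j : Fin d) :
    toTorusObservable M (fun U : LGConfig d G => (N : ℝ) - plaquetteObs ρ 0 i j U) =
      fun U : GaugeConfig d M G => (N : ℝ) - (ρ (plaquetteHolonomy U 0 i j)).trace.re := by
  funext U
  simp only [toTorusObservable_apply, plaquetteObs, FreeEnergy.plaquetteHolonomyZd_torusLift,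
    EquipartitionPinsProbe.Equipartition.torusProj_zero]

/-- **KT1 per plaquette, finite tori.** A free-energy rate `|f_r(β) + (3D/2) log β − K| ≤ C β^{−κ}`
(`β ≥ β₀`) forces, for all large `β` and then eventually along the tori `Λ_{L+1}`,
`|β ⟨N − Re tr r(U_{0,ij})⟩_{β,L+1} − D/4| ≤ C' β^{−κ/2}` for every plane `i < j` (the observable is
`plaqCost0 r.ρ i j` of `WeakCouplingRatesCurrency`, by `rfl`): `budgetRate_torus` for the site energy
and the plane symmetry `wilsonExpectation_siteEnergy_eq_card_mul` (six planes). [cite: FriedliVelenik2017, Thm. 3.34] -/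
theorem budgetRate_torus_plane (r : LatticeRep G) {D : ℕ} {K κ C β₀ : ℝ} (hκ : 0 < κ)
    (hrate : ∀ β : ℝ, β₀ ≤ β →
      |freeEnergyDensity 4 r.ρ β + (3 * (D : ℝ) / 2) * Real.log β - K| ≤ C * β ^ (-κ))
    {i j : Fin 4} (hij : i < j) :
    ∃ C' β₁ : ℝ, ∀ β : ℝ, β₁ ≤ β → ∀ᶠ L : ℕ in atTop,
      |β * wilsonExpectation (L := L + 1) r.ρ β (toTorusObservable (L + 1)
          fun U : LGConfig 4 G => (r.N : ℝ) - plaquetteObs r.ρ 0 i j U) - (D : ℝ) / 4| ≤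
        C' * β ^ (-(κ / 2)) := by
  haveI : SecondCountableTopology (Matrix (Fin r.N) (Fin r.N) ℂ) :=
    inferInstanceAs (SecondCountableTopology (Fin r.N → Fin r.N → ℂ))
  haveI : SecondCountableTopology G :=
    (r.continuous.isClosedEmbedding r.injective).isEmbedding.secondCountableTopology
  obtain ⟨C', β₁, h⟩ := budgetRate_torus r hκ hrate
  refine ⟨C' / 6, β₁, fun β hβ => ?_⟩
  -- six coordinate planes (tree `CurvatureBoostCovariance.Negative.card_planes`, not imported here)
  have h6 : Fintype.card {q : Fin 4 × Fin 4 // q.1 < q.2} = 6 := by decide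
  filter_upwards [h β hβ] with L hL
  rw [EquipartitionPinsProbe.Equipartition.toTorusObservable_siteEnergy r.ρ (L + 1),
    wilsonExpectation_siteEnergy_eq_card_mul r.ρ r.continuous β (L + 1) (ne_of_lt hij), h6] at hL
  rw [toTorusObservable_plaqCost r.ρ (L + 1) i j]
  set e := wilsonExpectation (L := L + 1) r.ρ β
    (fun U : GaugeConfig 4 (L + 1) G => (r.N : ℝ) - (r.ρ (plaquetteHolonomy U 0 i j)).trace.re)
  have e6 : β * ((6 : ℕ) * e) - 3 * (D : ℝ) / 2 = 6 * (β * e - (D : ℝ) / 4) := by push_cast; ring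
  rw [e6, abs_mul, abs_of_pos (by norm_num : (0 : ℝ) < 6)] at hL
  have : |β * e - (D : ℝ) / 4| ≤ C' / 6 * β ^ (-(κ / 2)) := by
    rw [div_mul_eq_mul_div, le_div_iff₀ (by norm_num : (0 : ℝ) < 6)]
    linarith
  exact this

omit [MeasurableSpace G] [BorelSpace G] [TopologicalSpace G] [IsTopologicalGroup G] [CompactSpace G] in
/-- The cost of the plaquette at the origin of `ℤ^d` in the plane `i < j` is a cylinder observable. [folklore] -/
theorem isCylinder_plaqCost {i j : Fin d} (hij : i < j) :
    IsCylinder (fun U : LGConfig d G => (N : ℝ) - plaquetteObs ρ 0 i j U)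
      (plaquetteEdges ((0 : Literature.Probability.LatticeModels.Site d), ⟨(i, j), hij⟩)) := by
  intro U V hUV
  have h := isCylinder_plaquetteObs ρ ((0 : Literature.Probability.LatticeModels.Site d), ⟨(i, j), hij⟩) hUV
  simp only at h ⊢
  rw [h]

/-- **KT1 per plaquette, torus-limit states.** A free-energy rate
`|f_r(β) + (3D/2) log β − K| ≤ C β^{−κ}` (`β ≥ β₀`) forces `|β E_μ[N − Re tr r(U_{0,ij})] − D/4| ≤ C' β^{−κ/2}`
for all large `β`, every torus-limit state `μ ∈ infiniteVolumeLimitPoints r.ρ β` and every plane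
`i < j`: the torus expectations defining `μ` are plane-symmetric, so `E_μ[s₀] = 6 E_μ[c_{ij}]`, and
`budgetRate_limitStates` applies. [cite: FriedliVelenik2017, Thm. 3.34] -/
theorem budgetRate_limitStates_plane (r : LatticeRep G) {D : ℕ} {K κ C β₀ : ℝ} (hκ : 0 < κ)
    (hrate : ∀ β : ℝ, β₀ ≤ β →
      |freeEnergyDensity 4 r.ρ β + (3 * (D : ℝ) / 2) * Real.log β - K| ≤ C * β ^ (-κ))
    {i j : Fin 4} (hij : i < j) :
    ∃ C' β₁ : ℝ, ∀ β : ℝ, β₁ ≤ β → ∀ μ ∈ infiniteVolumeLimitPoints (d := 4) r.ρ β,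
      |β * (∫ U, ((r.N : ℝ) - plaquetteObs r.ρ 0 i j U) ∂μ) - (D : ℝ) / 4| ≤
        C' * β ^ (-(κ / 2)) := by
  haveI : SecondCountableTopology (Matrix (Fin r.N) (Fin r.N) ℂ) :=
    inferInstanceAs (SecondCountableTopology (Fin r.N → Fin r.N → ℂ))
  haveI : SecondCountableTopology G :=
    (r.continuous.isClosedEmbedding r.injective).isEmbedding.secondCountableTopology
  obtain ⟨C', β₁, h⟩ := budgetRate_limitStates r hκ hrate
  refine ⟨C' / 6, β₁, fun β hβ μ hμ => ?_⟩
  have hs := h β hβ μ hμ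
  obtain ⟨φ, hφ, hμφ⟩ := hμ
  -- the two expectations as limits along the tori `φ k + 1`
  have hc : Tendsto (fun k : ℕ => wilsonExpectation (L := φ k + 1) r.ρ β
      (toTorusObservable (φ k + 1) fun U : LGConfig 4 G => (r.N : ℝ) - plaquetteObs r.ρ 0 i j U))
      atTop (𝓝 (∫ U, ((r.N : ℝ) - plaquetteObs r.ρ 0 i j U) ∂μ)) := by
    refine hμφ.2 _ _ (isCylinder_plaqCost r.ρ hij)
      (continuous_const.sub (continuous_plaquetteObs r.ρ r.continuous 0 i j)) ?_
    obtain ⟨B, -, hB⟩ := exists_bound_trace_re_nonneg r.ρ r.continuous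
    refine ⟨(r.N : ℝ) + B, fun U => (abs_sub _ _).trans ?_⟩
    rw [Nat.abs_cast]
    exact add_le_add le_rfl (hB _)
  have hsite : Tendsto (fun k : ℕ => wilsonExpectation (L := φ k + 1) r.ρ β
      (toTorusObservable (φ k + 1) fun U : LGConfig 4 G => ∑ i : Fin 4, ∑ j : Fin 4,
        if i < j then ((r.N : ℝ) - plaquetteObs r.ρ 0 i j U) else 0))
      atTop (𝓝 (∫ U, (∑ i : Fin 4, ∑ j : Fin 4,
        if i < j then ((r.N : ℝ) - plaquetteObs r.ρ 0 i j U) else 0) ∂μ)) :=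
    hμφ.2 _ _ (EquipartitionPinsProbe.Equipartition.isCylinder_siteEnergy r.ρ)
      (EquipartitionPinsProbe.Equipartition.continuous_siteEnergy r.ρ r.continuous)
      (EquipartitionPinsProbe.Equipartition.exists_abs_siteEnergy_le r.ρ r.continuous)
  -- on each torus, site energy `= 6 ×` plaquette cost
  have heq : ∀ k : ℕ, wilsonExpectation (L := φ k + 1) r.ρ β
      (toTorusObservable (φ k + 1) fun U : LGConfig 4 G => ∑ i : Fin 4, ∑ j : Fin 4,
        if i < j then ((r.N : ℝ) - plaquetteObs r.ρ 0 i j U) else 0) =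
      (6 : ℝ) * wilsonExpectation (L := φ k + 1) r.ρ β
        (toTorusObservable (φ k + 1) fun U : LGConfig 4 G => (r.N : ℝ) - plaquetteObs r.ρ 0 i j U) := by
    intro k
    have h6 : Fintype.card {q : Fin 4 × Fin 4 // q.1 < q.2} = 6 := by decide
    rw [EquipartitionPinsProbe.Equipartition.toTorusObservable_siteEnergy r.ρ (φ k + 1),
      wilsonExpectation_siteEnergy_eq_card_mul r.ρ r.continuous β (φ k + 1) (ne_of_lt hij),
      h6, toTorusObservable_plaqCost r.ρ (φ k + 1) i j]
    push_cast
    ring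
  have hsite' := (hc.const_mul (6 : ℝ)).congr fun k => (heq k).symm
  have hlim := tendsto_nhds_unique hsite hsite'
  rw [hlim] at hs
  set e := ∫ U, ((r.N : ℝ) - plaquetteObs r.ρ 0 i j U) ∂μ
  have e6 : β * (6 * e) - 3 * (D : ℝ) / 2 = 6 * (β * e - (D : ℝ) / 4) := by ring
  rw [e6, abs_mul, abs_of_pos (by norm_num : (0 : ℝ) < 6)] at hs
  rw [div_mul_eq_mul_div, le_div_iff₀ (by norm_num : (0 : ℝ) < 6)]
  linarith

end Summit.QuantumFields.YangMills.Theorems.EntropyBudgetEquipartition.BudgetRate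

end
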